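import Mathlib
import Summits.QuantumAdvantage.QuantumAdvantage.Theses.WhiteBoxWalk
import Literature.Computability.QuantumComplexity.SinkOfVerifiableLine

/-!
# Sketch (crux-ideate gen 2, ideator 2) — idea `first-hit-union-bound`

First lemma of the line: Gao's quantum union bound (sequential projective measurements) and its
deterministic companion (the projected branch is close to the unmeasured trajectory), stated over
an arbitrary complex inner-product space with elementary hypotheses (isometries `U t`,
self-adjoint idempotent `P t`). `ProjectedBranchClose` is PROVED here (telescoping);
`QuantumUnionBound` is the printed theorem (Gao 2015 Thm 1; O'Donnell–Venkateswaran 2021),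
stated only. `Diagonal` is the sibling transfer target (Ideator3SketchG2) the line aims at.
-/

open scoped InnerProductSpace BigOperators

noncomputable section

set_option linter.dupNamespace false

namespace Summit.QuantumAdvantage.QuantumAdvantage.Cruxes.WbwVerifiableLineNoSpeedup.FirstHit

open Literature.Computability.Cryptography Literature.Computability.QuantumComplexity

section Abstract

variable {E : Type*} [NormedAddCommGroup E] [InnerProductSpace ℂ E]

/-- Unmeasured trajectory `ψ_{t+1} = U_t ψ_t`. -/
def traj (U : ℕ → E →L[ℂ] E) (ψ₀ : E) : ℕ → E
  | 0 => ψ₀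
  | t + 1 => U t (traj U ψ₀ t)

/-- Measured (projected, "innocent") branch `φ_{t+1} = P_t (U_t φ_t)`. -/
def projTraj (U P : ℕ → E →L[ℂ] E) (ψ₀ : E) : ℕ → E
  | 0 => ψ₀
  | t + 1 => P t (U t (projTraj U P ψ₀ t))

/-- Rejection probability of `P_t` on the UNMEASURED state: `ε_t = ‖(1 - P_t) U_t ψ_t‖²`. -/
def rejProb (U P : ℕ → E →L[ℂ] E) (ψ₀ : E) (t : ℕ) : ℝ :=
  ‖traj U ψ₀ (t + 1) - P t (traj U ψ₀ (t + 1))‖ ^ 2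

@[simp] theorem traj_succ (U : ℕ → E →L[ℂ] E) (ψ₀ : E) (t : ℕ) :
    traj U ψ₀ (t + 1) = U t (traj U ψ₀ t) := rfl

@[simp] theorem projTraj_succ (U P : ℕ → E →L[ℂ] E) (ψ₀ : E) (t : ℕ) :
    projTraj U P ψ₀ (t + 1) = P t (U t (projTraj U P ψ₀ t)) := rfl

/-- Key one-step identity behind both bounds: for a self-adjoint idempotent `P`, an isometry `U`,
`χ' := U ψ - P (U φ)` with `χ := ψ - φ` satisfies
`‖χ'‖² = ‖χ‖² + ‖(1-P) U ψ‖² - ‖(1-P) U χ‖²` (so `‖χ'‖² ≤ ‖χ‖² + ε`). -/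
theorem norm_sq_step (U P : E →L[ℂ] E) (hU : ∀ v, ‖U v‖ = ‖v‖)
    (hPsa : ∀ v w, ⟪P v, w⟫_ℂ = ⟪v, P w⟫_ℂ) (hPid : ∀ v, P (P v) = P v) (ψ φ : E) :
    ‖U ψ - P (U φ)‖ ^ 2 =
      ‖ψ - φ‖ ^ 2 + ‖U ψ - P (U ψ)‖ ^ 2 - ‖(U ψ - U φ) - P (U ψ - U φ)‖ ^ 2 := by
  -- write everything in terms of a := (1-P)(U φ) and d := U ψ - U φ
  have hdn : ‖U ψ - U φ‖ = ‖ψ - φ‖ := by rw [← map_sub, hU]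
  rw [← hdn]
  set d : E := U ψ - U φ with hd
  set a : E := U φ - P (U φ) with ha
  have hχ : U ψ - P (U φ) = d + a := by
    simp only [hd, ha]
    abel
  have hε : U ψ - P (U ψ) = (d - P d) + a := by
    simp only [hd, ha, map_sub]
    abel
  -- `a` is in the range of `1 - P`, hence orthogonal to the range of `P`
  have hPa : P a = 0 := by simp [ha, map_sub, hPid]
  clear_value d a
  have horth : ∀ v, ⟪P v, a⟫_ℂ = 0 := by
    intro v
    rw [hPsa, hPa, inner_zero_right]
  have hsplit : ⟪d - P d, a⟫_ℂ = ⟪d, a⟫_ℂ := by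
    rw [inner_sub_left, horth, sub_zero]
  rw [hχ, hε]
  have e1 : ‖d + a‖ ^ 2 = ‖d‖ ^ 2 + 2 * RCLike.re ⟪d, a⟫_ℂ + ‖a‖ ^ 2 :=
    norm_add_sq (𝕜 := ℂ) d a
  have e2 : ‖(d - P d) + a‖ ^ 2 =
      ‖d - P d‖ ^ 2 + 2 * RCLike.re ⟪d - P d, a⟫_ℂ + ‖a‖ ^ 2 :=
    norm_add_sq (𝕜 := ℂ) (d - P d) a
  rw [e1, e2, hsplit]
  ring

/-- **Companion (proved): the projected branch is close to the unmeasured trajectory**,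
`‖ψ_q - φ_q‖² ≤ Σ_{t<q} ε_t`, constant `1`. -/
theorem projectedBranch_close (U P : ℕ → E →L[ℂ] E) (ψ₀ : E)
    (hU : ∀ t v, ‖U t v‖ = ‖v‖) (hPsa : ∀ t v w, ⟪P t v, w⟫_ℂ = ⟪v, P t w⟫_ℂ)
    (hPid : ∀ t v, P t (P t v) = P t v) (q : ℕ) :
    ‖traj U ψ₀ q - projTraj U P ψ₀ q‖ ^ 2 ≤ ∑ t ∈ Finset.range q, rejProb U P ψ₀ t := by
  induction q with
  | zero => simp [traj, projTraj]
  | succ q ih =>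
    have hstep := norm_sq_step (U q) (P q) (hU q) (hPsa q) (hPid q)
      (traj U ψ₀ q) (projTraj U P ψ₀ q)
    have hrej : rejProb U P ψ₀ q =
        ‖U q (traj U ψ₀ q) - P q (U q (traj U ψ₀ q))‖ ^ 2 := rfl
    have h0 : 0 ≤ ‖(U q (traj U ψ₀ q) - U q (projTraj U P ψ₀ q)) -
        P q (U q (traj U ψ₀ q) - U q (projTraj U P ψ₀ q))‖ ^ 2 := by positivity
    rw [Finset.sum_range_succ, traj_succ, projTraj_succ, hstep, hrej]
    linarith [ih]

/-- A self-adjoint idempotent is a contraction. -/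
theorem norm_proj_le (P : E →L[ℂ] E) (hPsa : ∀ v w, ⟪P v, w⟫_ℂ = ⟪v, P w⟫_ℂ)
    (hPid : ∀ v, P (P v) = P v) (v : E) : ‖P v‖ ≤ ‖v‖ := by
  have h1 : ‖P v‖ ^ 2 = RCLike.re ⟪v, P v⟫_ℂ := by
    have : ⟪P v, P v⟫_ℂ = ⟪v, P v⟫_ℂ := by rw [hPsa, hPid]
    rw [← this]
    exact (norm_sq_eq_re_inner (𝕜 := ℂ) (P v))
  have h2 : RCLike.re ⟪v, P v⟫_ℂ ≤ ‖v‖ * ‖P v‖ := re_inner_le_norm v (P v)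
  have h3 : ‖P v‖ ^ 2 ≤ ‖v‖ * ‖P v‖ := h1 ▸ h2
  nlinarith [norm_nonneg (P v), norm_nonneg v]

/-- Isometries preserve the norm along the unmeasured trajectory. -/
theorem norm_traj (U : ℕ → E →L[ℂ] E) (ψ₀ : E) (hU : ∀ t v, ‖U t v‖ = ‖v‖) (t : ℕ) :
    ‖traj U ψ₀ t‖ = ‖ψ₀‖ := by
  induction t with
  | zero => rfl
  | succ t ih => rw [traj_succ, hU, ih]

/-- The projected branch only loses norm. -/
theorem norm_projTraj_le (U P : ℕ → E →L[ℂ] E) (ψ₀ : E) (hU : ∀ t v, ‖U t v‖ = ‖v‖)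
    (hPsa : ∀ t v w, ⟪P t v, w⟫_ℂ = ⟪v, P t w⟫_ℂ) (hPid : ∀ t v, P t (P t v) = P t v) (t : ℕ) :
    ‖projTraj U P ψ₀ t‖ ≤ ‖ψ₀‖ := by
  induction t with
  | zero => exact le_rfl
  | succ t ih =>
    rw [projTraj_succ]
    calc ‖P t (U t (projTraj U P ψ₀ t))‖ ≤ ‖U t (projTraj U P ψ₀ t)‖ :=
          norm_proj_le (P t) (hPsa t) (hPid t) _
      _ = ‖projTraj U P ψ₀ t‖ := hU t _
      _ ≤ ‖ψ₀‖ := ih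

/-- **First-hit mass identity**: the squared norms of the first-hit pieces
`a_t := (1 - P_t) U_t φ_t` add up to the lost acceptance probability `‖ψ₀‖² - ‖φ_q‖²`. -/
theorem firstHit_sum (U P : ℕ → E →L[ℂ] E) (ψ₀ : E) (hU : ∀ t v, ‖U t v‖ = ‖v‖)
    (hPsa : ∀ t v w, ⟪P t v, w⟫_ℂ = ⟪v, P t w⟫_ℂ) (hPid : ∀ t v, P t (P t v) = P t v) (q : ℕ) :
    ∑ t ∈ Finset.range q, ‖U t (projTraj U P ψ₀ t) - projTraj U P ψ₀ (t + 1)‖ ^ 2 =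
      ‖ψ₀‖ ^ 2 - ‖projTraj U P ψ₀ q‖ ^ 2 := by
  induction q with
  | zero => simp [projTraj]
  | succ q ih =>
    rw [Finset.sum_range_succ, ih, projTraj_succ]
    set w : E := U q (projTraj U P ψ₀ q) with hw
    -- Pythagoras: ‖w‖² = ‖P w‖² + ‖w - P w‖², and ‖w‖ = ‖φ_q‖
    have horth : ⟪P q w, w - P q w⟫_ℂ = 0 := by
      rw [inner_sub_right, hPsa q w (P q w), hPid, hPsa q w w, sub_self]
    have hpy : ‖P q w + (w - P q w)‖ ^ 2 = ‖P q w‖ ^ 2 + ‖w - P q w‖ ^ 2 := by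
      have := norm_add_sq (𝕜 := ℂ) (P q w) (w - P q w)
      rw [horth] at this
      simpa using this
    have hsum : P q w + (w - P q w) = w := by abel
    rw [hsum] at hpy
    have hwn : ‖w‖ = ‖projTraj U P ψ₀ q‖ := by rw [hw, hU]
    rw [← hwn]
    linarith

/-- **Weak quantum union bound (proved; suffices for the line)**: for a unit start vector,
`1 - ‖φ_q‖² ≤ 2 √(Σ_{t<q} ε_t)`. Gao's theorem (`QuantumUnionBound` below) improves the
right-hand side to `4 Σ ε_t`; the line only needs SOME bound tending to `0` with `Σ ε_t`. -/
theorem weak_union_bound (U P : ℕ → E →L[ℂ] E) (ψ₀ : E) (hψ : ‖ψ₀‖ = 1)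
    (hU : ∀ t v, ‖U t v‖ = ‖v‖) (hPsa : ∀ t v w, ⟪P t v, w⟫_ℂ = ⟪v, P t w⟫_ℂ)
    (hPid : ∀ t v, P t (P t v) = P t v) (q : ℕ) :
    1 - ‖projTraj U P ψ₀ q‖ ^ 2 ≤ 2 * Real.sqrt (∑ t ∈ Finset.range q, rejProb U P ψ₀ t) := by
  set s : ℝ := Real.sqrt (∑ t ∈ Finset.range q, rejProb U P ψ₀ t) with hs
  have hc : ‖traj U ψ₀ q - projTraj U P ψ₀ q‖ ≤ s := by
    rw [hs, ← Real.sqrt_sq (norm_nonneg (traj U ψ₀ q - projTraj U P ψ₀ q))]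
    exact Real.sqrt_le_sqrt (projectedBranch_close U P ψ₀ hU hPsa hPid q)
  have h1 : ‖traj U ψ₀ q‖ = 1 := by rw [norm_traj U ψ₀ hU, hψ]
  have h2 : ‖projTraj U P ψ₀ q‖ ≤ 1 := hψ ▸ norm_projTraj_le U P ψ₀ hU hPsa hPid q
  have h3 : 1 - ‖projTraj U P ψ₀ q‖ ≤ s := by
    have := norm_sub_norm_le (traj U ψ₀ q) (projTraj U P ψ₀ q)
    rw [h1] at this
    exact this.trans hc
  have h4 : 0 ≤ ‖projTraj U P ψ₀ q‖ := norm_nonneg _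
  nlinarith [h2, h3, h4]

/-- The deterministic companion as a named Prop (for the line card). -/
def ProjectedBranchClose : Prop :=
  ∀ (E : Type) [NormedAddCommGroup E] [InnerProductSpace ℂ E] (U P : ℕ → E →L[ℂ] E) (ψ₀ : E),
    (∀ t v, ‖U t v‖ = ‖v‖) → (∀ t v w, ⟪P t v, w⟫_ℂ = ⟪v, P t w⟫_ℂ) →
    (∀ t v, P t (P t v) = P t v) →
    ∀ q : ℕ, ‖traj U ψ₀ q - projTraj U P ψ₀ q‖ ^ 2 ≤ ∑ t ∈ Finset.range q, rejProb U P ψ₀ t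

theorem projectedBranchClose_holds : ProjectedBranchClose :=
  fun _ _ _ U P ψ₀ hU hPsa hPid q => projectedBranch_close U P ψ₀ hU hPsa hPid q

/-- **FIRST LEMMA of the line — Gao's quantum union bound** (J. Gao, *Quantum union bounds for
sequential projective measurements*, Phys. Rev. A 92 (2015) 052331, Thm. 1; R. O'Donnell,
R. Venkateswaran, *The quantum union bound made easy*, SOSA 2022, arXiv:2103.07827, Thm. 1.1):
for a unit start vector, isometries `U_t` and orthogonal projections `P_t`, the probability that
the sequential measurements `{P_t, 1 - P_t}` ALL accept, `‖φ_q‖²`, is at least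
`1 - 4 Σ_{t<q} ε_t`, where `ε_t` is the rejection probability of `P_t` on the UNMEASURED state
`ψ_{t+1} = U_t ψ_t`. (Not proved here; ~40 lines after O'Donnell–Venkateswaran.) -/
def QuantumUnionBound : Prop :=
  ∀ (E : Type) [NormedAddCommGroup E] [InnerProductSpace ℂ E] (U P : ℕ → E →L[ℂ] E) (ψ₀ : E),
    ‖ψ₀‖ = 1 → (∀ t v, ‖U t v‖ = ‖v‖) → (∀ t v w, ⟪P t v, w⟫_ℂ = ⟪v, P t w⟫_ℂ) →
    (∀ t v, P t (P t v) = P t v) →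
    ∀ q : ℕ, 1 - ‖projTraj U P ψ₀ q‖ ^ 2 ≤ 4 * ∑ t ∈ Finset.range q, rejProb U P ψ₀ t

end Abstract

/-! ### The target the line aims at (sibling transfer, Ideator3SketchG2: `Diagonal` ⟹ crux) -/

/-- `Q_{1/3}` of the SVL sink bit. -/
abbrev svlQ (m T : ℕ) : ℕ := quantumQueryComplexityOn (1 / 3) (svlPromise m T) (svlSinkBit m T)

/-- The diagonal statement (one asymptotic point per `m`): `κ · 2^{m/2} ≤ Q(m, 2^{m/2-3})`. With
`PaddingMonotone`, `DilationMonotone`, `OneLe` (Ideator3SketchG2, checked) and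
`crux_of_smallT_of_padding` (Disproof §7.3, checked) it implies `WbwVerifiableLineNoSpeedup`. -/
def Diagonal : Prop :=
  ∃ κ : ℝ, 0 < κ ∧ ∀ m : ℕ, 6 ≤ m → κ * (2 : ℝ) ^ (m / 2) ≤ (svlQ m (2 ^ (m / 2 - 3)) : ℝ)

/-- Sanity: the crux decl is in scope by name. -/
example : Prop := Summit.QuantumAdvantage.QuantumAdvantage.Theses.WhiteBoxWalk.WbwVerifiableLineNoSpeedup

end Summit.QuantumAdvantage.QuantumAdvantage.Cruxes.WbwVerifiableLineNoSpeedup.FirstHit
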